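import Summits.NavierStokesRegularity.NavierStokesRegularity.Theorems.AdaptedFrequencyAdaptedFrequencyConvergesStubKernelCalculusIBP
import Literature.Analysis.FluidPDE.NSGaldiExtendedTest

/-! # Kernel calculus II: the transport-free first variation `d/dt ∫ q G = ∫ (∂ₜq + u·∇q − νΔq) G` — crux stmt-NavierStokesRegularity-10493 (`AdaptedFrequency.AdaptedFrequencyConverges`), line tauberian-omega-limit, stub stub_kernelCalculus

Helper file 2/3 (`--supports stmt-NavierStokesRegularity-10493`) for the registered stub
`stub_kernelCalculus`. For a flow-adapted backward kernel `G` of `∂ₜ + u·∇ − νΔ` on `S`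
(`IsAdaptedBackwardKernel`), an open `S₀ ⊆ S` on which `G` is dominated by a fixed integrable
majorant `M` (in the stub: the Gaussian upper bound of `IsGaussianComparable` on a compact time
window), a bounded divergence-free `C¹` drift `u` and a jointly `C²` scalar field `q` on `S₀ × E`
with `q`, `Dq`, `D²q`, `∂ₜq` bounded, the functional `s ↦ ∫ q(s) G(s)` is differentiable at every
`t ∈ S₀` with derivative `∫ (∂ₜq + u·∇q − νΔq) G(t)`
(`kernelCalculus_hasDerivAt_integral_mul_kernel`; Friedman 1964, Ch. 1 §8: `G` is a fundamental
solution of the adjoint equation; Poon 1996: first variation of weighted energies against a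
backward kernel). Proof: the cut-off functionals `∫ q χ_R G` of file 1/3
(`kernelCalculus_hasDerivAt_cutoffIntegral`) converge pointwise (dominated convergence, unit-mass
slices), and their derivatives converge **uniformly on `S₀`**: the error integrand vanishes on
`‖x‖ < R`, is bounded by a constant (Leibniz bounds for `q χ_R` with the derivatives of `χ_R`
bounded uniformly in `R ≥ 1`, `exists_norm_iteratedFDeriv_cutoff_le` of the tree, `kernelCalculus_cutoffProduct_bound`)
and is integrated against `G ≤ M`, whence an error `≤ C ∫_{‖x‖ ≥ R} M → 0`; the uniform limit
theorem for derivatives (Mathlib `hasDerivAt_of_tendstoUniformlyOn`) concludes.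
-/

noncomputable section

open scoped Topology InnerProductSpace RealInnerProductSpace Laplacian ContDiff
open Literature.Analysis.FluidPDE Set Filter MeasureTheory Function Metric

namespace Summit.NavierStokesRegularity.NavierStokesRegularity.Theorems.AdaptedFrequencyConverges.TauberianOmegaLimit

section General

variable {E : Type*} [NormedAddCommGroup E] [InnerProductSpace ℝ E] [FiniteDimensional ℝ E]

/-! ### Step B: removing the cut-off -/

/-- Inside the ball `‖x‖ < R` the cut-off product `q χ_R` agrees with `q` to second order. -/
theorem kernelCalculus_cutoffProduct_eq {f : E → ℝ} {R : ℝ} (hR : 0 < R) {x : E} (hx : ‖x‖ < R) :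
    cutoff R x = 1 ∧ fderiv ℝ (fun y => f y * cutoff R y) x = fderiv ℝ f x ∧
      (Δ (fun y => f y * cutoff R y)) x = (Δ f) x := by
  have hev : (fun y => f y * cutoff R y) =ᶠ[𝓝 x] f := by
    have : ball (0 : E) R ∈ 𝓝 x := isOpen_ball.mem_nhds (mem_ball_zero_iff.2 hx)
    filter_upwards [this] with y hy
    rw [mem_ball_zero_iff] at hy
    rw [cutoff_eq_one hR hy.le, mul_one]
  exact ⟨cutoff_eq_one hR hx.le, hev.fderiv_eq,
    (InnerProductSpace.laplacian_congr_nhds hev).eq_of_nhds⟩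

/-- Leibniz bounds for the cut-off product: if `‖Dᵏf‖ ≤ K` and `‖Dᵏχ_R‖ ≤ Cχ` for `k ≤ 2`, then
`‖D(f χ_R)‖ ≤ 2 K Cχ` and `‖Δ(f χ_R)‖ ≤ 4 n K Cχ`. -/
theorem kernelCalculus_cutoffProduct_bound {f : E → ℝ} (hf : ContDiff ℝ 2 f) {K Cχ R : ℝ}
    (hK : ∀ k ≤ 2, ∀ x, ‖iteratedFDeriv ℝ k f x‖ ≤ K)
    (hCχ : ∀ k ≤ 2, ∀ x, ‖iteratedFDeriv ℝ k (cutoff (E := E) R) x‖ ≤ Cχ) (x : E) :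
    ‖fderiv ℝ (fun y => f y * cutoff R y) x‖ ≤ 2 * K * Cχ ∧
      ‖(Δ (fun y => f y * cutoff R y)) x‖ ≤ Module.finrank ℝ E * (4 * K * Cχ) := by
  have hχ : ContDiff ℝ 2 (cutoff (E := E) R) := contDiff_cutoff R
  have hK0 : 0 ≤ K := (norm_nonneg _).trans (hK 0 (by norm_num) x)
  have hk : ∀ k ≤ 2, ‖iteratedFDeriv ℝ k (fun y => f y * cutoff R y) x‖ ≤ 2 ^ k * K * Cχ := by
    intro k hk
    refine (norm_iteratedFDeriv_mul_le hf hχ x (n := k) (by exact_mod_cast hk)).trans ?_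
    calc ∑ i ∈ Finset.range (k + 1), (k.choose i : ℝ) * ‖iteratedFDeriv ℝ i f x‖ *
          ‖iteratedFDeriv ℝ (k - i) (cutoff R) x‖
        ≤ ∑ i ∈ Finset.range (k + 1), (k.choose i : ℝ) * K * Cχ := by
          refine Finset.sum_le_sum fun i hi => ?_
          have hi' : i ≤ k := Nat.lt_succ_iff.mp (Finset.mem_range.mp hi)
          have h1 := hK i (hi'.trans hk) x
          have h2 := hCχ (k - i) ((Nat.sub_le k i).trans hk) x
          gcongr
      _ = 2 ^ k * K * Cχ := by
          rw [← Finset.sum_mul, ← Finset.sum_mul]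
          congr 2
          exact_mod_cast Nat.sum_range_choose k
  constructor
  · have h1 := hk 1 (by norm_num)
    rw [norm_iteratedFDeriv_one] at h1
    linarith
  · refine (kernelCalculus_norm_laplacian_le _ x).trans ?_
    have h2 := hk 2 le_rfl
    have : ‖iteratedFDeriv ℝ 2 (fun y => f y * cutoff R y) x‖ ≤ 4 * K * Cχ := by linarith
    gcongr

variable [MeasurableSpace E] [BorelSpace E]

/-- Tails of an integrable majorant: `∫_{‖x‖ ≥ n + 1} M → 0`. -/
theorem kernelCalculus_tendsto_tail {M : E → ℝ} (hM : Integrable M) :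
    Tendsto (fun n : ℕ => ∫ x, indicator {x : E | (n : ℝ) + 1 ≤ ‖x‖} M x) atTop (𝓝 0) := by
  have hmeas : ∀ n : ℕ, MeasurableSet {x : E | (n : ℝ) + 1 ≤ ‖x‖} := fun n =>
    (isClosed_le continuous_const continuous_norm).measurableSet
  have h := tendsto_integral_of_dominated_convergence (μ := volume)
    (F := fun (n : ℕ) x => indicator {x : E | (n : ℝ) + 1 ≤ ‖x‖} M x) (f := fun _ => (0 : ℝ))
    (fun x => ‖M x‖) (fun n => hM.aestronglyMeasurable.indicator (hmeas n)) hM.norm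
    (fun n => Eventually.of_forall fun x => norm_indicator_le_norm_self _ _) ?_
  · simpa using h
  · refine Eventually.of_forall fun x => tendsto_const_nhds.congr' ?_
    filter_upwards [eventually_gt_atTop ⌈‖x‖⌉₊] with n hn
    rw [indicator_of_notMem]
    simp only [mem_setOf_eq, not_le]
    have h1 : (⌈‖x‖⌉₊ : ℝ) < n := by exact_mod_cast hn
    linarith [Nat.le_ceil ‖x‖]

/-- **The kernel calculus (core).** Let `G` be an adapted backward kernel of `∂ₜ + u·∇ − νΔ` on
`S`, dominated on an open `S₀ ⊆ S` by a fixed integrable `M`; let the drift be `C¹`,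
divergence free and bounded on `S₀`, and let `q` be a jointly `C²` scalar field on `S₀ × E` with
`q`, `Dq`, `D²q`, `∂ₜq` bounded. Then `s ↦ ∫ q(s) G(s)` is differentiable at every `t ∈ S₀`, with
the **transport-free first variation** `d/dt ∫ q G = ∫ (∂ₜq + u·∇q − νΔq) G`. Proof: the cut-off
functionals `∫ q χ_R G` have this derivative with `q χ_R` in place of `q` (Step A), converge
pointwise, and their derivatives converge uniformly on `S₀` (the error is supported in
`‖x‖ ≥ R` and bounded by a constant times the tail `∫_{‖x‖ ≥ R} M`); conclude with the uniform
limit theorem for derivatives. -/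
theorem kernelCalculus_hasDerivAt_integral_mul_kernel {ν T : ℝ} {u : ℝ → E → E} {S S₀ : Set ℝ}
    {x₀ : E} {G q : ℝ → E → ℝ} {M : E → ℝ} {K U : ℝ}
    (hG : IsAdaptedBackwardKernel ν u S T x₀ G) (hS₀ : IsOpen S₀) (hS₀S : S₀ ⊆ S)
    (hM : Integrable M) (hGM : ∀ t ∈ S₀, ∀ x, G t x ≤ M x)
    (hu1 : ∀ t ∈ S₀, ContDiff ℝ 1 (u t)) (hdiv : ∀ t ∈ S₀, VectorCalculus.IsDivFree (u t))
    (hU : ∀ t ∈ S₀, ∀ x, ‖u t x‖ ≤ U) (hq : ContDiffOn ℝ 2 (uncurry q) (S₀ ×ˢ univ))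
    (hqK : ∀ k ≤ 2, ∀ t ∈ S₀, ∀ x, ‖iteratedFDeriv ℝ k (q t) x‖ ≤ K)
    (hqt : ∀ t ∈ S₀, ∀ x, |deriv (fun s => q s x) t| ≤ K) {t : ℝ} (ht : t ∈ S₀) :
    HasDerivAt (fun s => ∫ x, q s x * G s x)
      (∫ x, (deriv (fun s => q s x) t + fderiv ℝ (q t) x (u t x) - ν * (Δ (q t)) x) * G t x) t := by
  -- the time derivative of `q` as a joint derivative
  have hder : ∀ s ∈ S₀, ∀ x, deriv (fun r => q r x) s = fderiv ℝ (uncurry q) (s, x) (1, 0) :=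
    fun s hs x => (kernelCalculus_hasDerivAt_timeLine hS₀ hq (by norm_num) hs x).deriv
  have hK0 : 0 ≤ K := (norm_nonneg _).trans (hqK 0 (by norm_num) t ht 0)
  have hU0 : 0 ≤ U := (norm_nonneg _).trans (hU t ht 0)
  -- uniform bounds for the cut-offs `cutoff R`, `R ≥ 1`
  obtain ⟨C₀, -, hC₀⟩ := exists_norm_iteratedFDeriv_cutoff_le (E := E) 0
  obtain ⟨C₁, -, hC₁⟩ := exists_norm_iteratedFDeriv_cutoff_le (E := E) 1
  obtain ⟨C₂, -, hC₂⟩ := exists_norm_iteratedFDeriv_cutoff_le (E := E) 2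
  obtain ⟨Cχ, hCχ⟩ : ∃ Cχ : ℝ, ∀ R, 1 ≤ R → ∀ k ≤ 2, ∀ x : E,
      ‖iteratedFDeriv ℝ k (cutoff R) x‖ ≤ Cχ := by
    refine ⟨max C₀ (max C₁ C₂), fun R hR k hk x => ?_⟩
    interval_cases k
    · exact (hC₀ R hR x).trans (le_max_left _ _)
    · exact (hC₁ R hR x).trans ((le_max_left _ _).trans (le_max_right _ _))
    · exact (hC₂ R hR x).trans ((le_max_right _ _).trans (le_max_right _ _))
  -- slice facts
  have hqs : ∀ s ∈ S₀, ContDiff ℝ 2 (q s) := fun s hs => kernelCalculus_contDiff_slice hq hs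
  have hGs : ∀ s ∈ S₀, ContDiff ℝ 2 (G s) := fun s hs => hG.contDiff_slice (hS₀S hs)
  have hG0 : ∀ s ∈ S₀, ∀ x, 0 ≤ G s x := fun s hs x => (hG.pos s (hS₀S hs) x).le
  have hq0 : ∀ s ∈ S₀, ∀ x, |q s x| ≤ K := fun s hs x => by
    have := hqK 0 (by norm_num) s hs x
    rwa [norm_iteratedFDeriv_zero, Real.norm_eq_abs] at this
  have hq1 : ∀ s ∈ S₀, ∀ x, ‖fderiv ℝ (q s) x‖ ≤ K := fun s hs x => by
    have := hqK 1 (by norm_num) s hs x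
    rwa [norm_iteratedFDeriv_one] at this
  have hq2 : ∀ s ∈ S₀, ∀ x, ‖(Δ (q s)) x‖ ≤ Module.finrank ℝ E * K := fun s hs x =>
    (kernelCalculus_norm_laplacian_le _ x).trans (by have := hqK 2 le_rfl s hs x; gcongr)
  -- the common shape of the limit integrand and of the cut-off integrands
  set n₀ : ℝ := (Module.finrank ℝ E : ℝ) with hn₀
  have hshape : ∀ {f c : E → ℝ} {A B : ℝ} {s : ℝ}, s ∈ S₀ → ContDiff ℝ 2 f → Continuous c →
      (∀ x, |c x| ≤ 1) → (∀ x, ‖fderiv ℝ f x‖ ≤ A) → (∀ x, ‖(Δ f) x‖ ≤ B) →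
      (∀ x, |fderiv ℝ (uncurry q) (s, x) (1, 0) * c x + fderiv ℝ f x (u s x) - ν * (Δ f) x|
          ≤ K + A * U + |ν| * B) ∧
      Integrable fun x => (fderiv ℝ (uncurry q) (s, x) (1, 0) * c x + fderiv ℝ f x (u s x) -
        ν * (Δ f) x) * G s x := by
    intro f c A B s hs hf hc hc1 hA hB
    have hA0 : 0 ≤ A := (norm_nonneg _).trans (hA 0)
    have hbd : ∀ x, |fderiv ℝ (uncurry q) (s, x) (1, 0) * c x + fderiv ℝ f x (u s x) -
        ν * (Δ f) x| ≤ K + A * U + |ν| * B := fun x => by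
      have h1 : |fderiv ℝ (uncurry q) (s, x) (1, 0) * c x| ≤ K := by
        rw [abs_mul, ← hder s hs x]
        calc |deriv (fun r => q r x) s| * |c x| ≤ K * 1 :=
              mul_le_mul (hqt s hs x) (hc1 x) (abs_nonneg _) hK0
          _ = K := mul_one K
      have h2 : |fderiv ℝ f x (u s x)| ≤ A * U := by
        rw [← Real.norm_eq_abs]
        exact (ContinuousLinearMap.le_opNorm _ _).trans
          (mul_le_mul (hA x) (hU s hs x) (norm_nonneg _) hA0)
      have h3 : |ν * (Δ f) x| ≤ |ν| * B := by
        rw [abs_mul]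
        exact mul_le_mul_of_nonneg_left (by rw [← Real.norm_eq_abs]; exact hB x) (abs_nonneg ν)
      calc _ ≤ |fderiv ℝ (uncurry q) (s, x) (1, 0) * c x + fderiv ℝ f x (u s x)| +
            |ν * (Δ f) x| := abs_sub _ _
        _ ≤ |fderiv ℝ (uncurry q) (s, x) (1, 0) * c x| + |fderiv ℝ f x (u s x)| +
            |ν * (Δ f) x| := by gcongr; exact abs_add_le _ _
        _ ≤ K + A * U + |ν| * B := by linarith
    have hcont : Continuous fun x => fderiv ℝ (uncurry q) (s, x) (1, 0) * c x +
        fderiv ℝ f x (u s x) - ν * (Δ f) x :=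
      (((kernelCalculus_continuous_derivField hS₀ hq (by norm_num) hs).mul hc).add
        ((hf.continuous_fderiv (by norm_num)).clm_apply (hu1 s hs).continuous)).sub
        (continuous_const.mul (continuous_laplacian hf))
    refine ⟨hbd, (hG.integrable (hS₀S hs)).bdd_mul (c := K + A * U + |ν| * B)
      hcont.aestronglyMeasurable (Eventually.of_forall fun x => ?_)⟩
    rw [Real.norm_eq_abs]
    exact hbd x
  -- the limit integrand `g` and the cut-off integrands `gR n`
  obtain ⟨g, hg⟩ : ∃ g : ℝ → E → ℝ, g = fun s x =>
      fderiv ℝ (uncurry q) (s, x) (1, 0) + fderiv ℝ (q s) x (u s x) - ν * (Δ (q s)) x := ⟨_, rfl⟩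
  obtain ⟨gR, hgR⟩ : ∃ gR : ℕ → ℝ → E → ℝ, gR = fun (n : ℕ) (s : ℝ) (x : E) =>
      fderiv ℝ (uncurry q) (s, x) (1, 0) * cutoff ((n : ℝ) + 1) x +
        fderiv ℝ (fun y => q s y * cutoff ((n : ℝ) + 1) y) x (u s x) -
        ν * (Δ (fun y => q s y * cutoff ((n : ℝ) + 1) y)) x := ⟨_, rfl⟩
  have hRpos : ∀ n : ℕ, (0 : ℝ) < n + 1 := fun n => by positivity
  have hR1 : ∀ n : ℕ, (1 : ℝ) ≤ n + 1 := fun n => by simp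
  -- facts about `g`
  have hgf : ∀ s ∈ S₀, (∀ x, |g s x| ≤ K + K * U + |ν| * (n₀ * K)) ∧
      Integrable fun x => g s x * G s x := by
    intro s hs
    have h := hshape (c := fun _ => (1 : ℝ)) hs (hqs s hs) continuous_const (fun _ => by simp)
      (hq1 s hs) (hq2 s hs)
    simp only [mul_one] at h
    rw [hg]; exact h
  -- facts about `gR n`
  have hgRf : ∀ (n : ℕ), ∀ s ∈ S₀,
      (∀ x, |gR n s x| ≤ K + 2 * K * Cχ * U + |ν| * (n₀ * (4 * K * Cχ))) ∧
      Integrable fun x => gR n s x * G s x := by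
    intro n s hs
    have hθ : ContDiff ℝ 2 fun y => q s y * cutoff ((n : ℝ) + 1) y :=
      (hqs s hs).mul (contDiff_cutoff _)
    have hb := fun x => kernelCalculus_cutoffProduct_bound (hqs s hs) (R := (n : ℝ) + 1)
      (fun k hk x => hqK k hk s hs x) (fun k hk x => hCχ _ (hR1 n) k hk x) x
    have h := hshape (c := cutoff ((n : ℝ) + 1)) hs hθ (contDiff_cutoff (n := 0) _).continuous
      (abs_cutoff_le_one _) (fun x => (hb x).1) (fun x => (hb x).2)
    rw [hgR]; exact h
  -- `gR n s = g s` on the ball `‖x‖ < n + 1`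
  have hgRg : ∀ (n : ℕ), ∀ s x, ‖x‖ < (n : ℝ) + 1 → gR n s x = g s x := by
    intro n s x hx
    obtain ⟨h1, h2, h3⟩ := kernelCalculus_cutoffProduct_eq (f := q s) (hRpos n) hx
    simp only [hgR, hg, h1, h2, h3, mul_one]
  -- Step A for every `n`
  have hf : ∀ᶠ n : ℕ in atTop, ∀ s ∈ S₀,
      HasDerivAt (fun r => ∫ x, q r x * cutoff ((n : ℝ) + 1) x * G r x)
        (∫ x, gR n s x * G s x) s := by
    refine Eventually.of_forall fun n s hs => ?_
    rw [hgR]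
    exact kernelCalculus_hasDerivAt_cutoffIntegral hG hS₀ hS₀S hu1 hdiv hq (hRpos n) hs
  -- pointwise convergence of the cut-off functionals
  have hfg : ∀ s ∈ S₀, Tendsto (fun n : ℕ => ∫ x, q s x * cutoff ((n : ℝ) + 1) x * G s x) atTop
      (𝓝 (∫ x, q s x * G s x)) := by
    intro s hs
    refine tendsto_integral_of_dominated_convergence (fun x => K * G s x) (fun n => ?_)
      ((hG.integrable (hS₀S hs)).const_mul K) (fun n => Eventually.of_forall fun x => ?_)
      (Eventually.of_forall fun x => ?_)
    · exact (((hqs s hs).continuous.mul (contDiff_cutoff (n := 0) _).continuous).mul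
        (hGs s hs).continuous).aestronglyMeasurable
    · rw [Real.norm_eq_abs, abs_mul, abs_mul, abs_of_nonneg (hG0 s hs x)]
      calc |q s x| * |cutoff ((n : ℝ) + 1) x| * G s x ≤ K * 1 * G s x := by
            gcongr
            · exact hG0 s hs x
            · exact hq0 s hs x
            · exact abs_cutoff_le_one _ _
        _ = K * G s x := by rw [mul_one]
    · have h := ((tendsto_const_nhds (x := q s x)).mul (tendsto_cutoff_natCast_add_one x)).mul
        (tendsto_const_nhds (x := G s x))
      simpa using h
  -- uniform convergence of the derivatives
  obtain ⟨C, hC⟩ : ∃ C : ℝ, C = (K + K * U + |ν| * (n₀ * K)) +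
      (K + 2 * K * Cχ * U + |ν| * (n₀ * (4 * K * Cχ))) := ⟨_, rfl⟩
  have hf' : TendstoUniformlyOn (fun (n : ℕ) s => ∫ x, gR n s x * G s x)
      (fun s => ∫ x, g s x * G s x) atTop S₀ := by
    rw [Metric.tendstoUniformlyOn_iff]
    intro ε hε
    have hev : ∀ᶠ n : ℕ in atTop, C * ∫ x, indicator {x : E | (n : ℝ) + 1 ≤ ‖x‖} M x < ε := by
      have h := (kernelCalculus_tendsto_tail hM).const_mul C
      rw [mul_zero] at h
      exact h.eventually (gt_mem_nhds hε)
    filter_upwards [hev] with n hn s hs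
    have hmeas : MeasurableSet {x : E | (n : ℝ) + 1 ≤ ‖x‖} :=
      (isClosed_le continuous_const continuous_norm).measurableSet
    have hbound : ∀ x, ‖(g s x - gR n s x) * G s x‖ ≤
        C * indicator {x : E | (n : ℝ) + 1 ≤ ‖x‖} M x := fun x => by
      by_cases hx : (n : ℝ) + 1 ≤ ‖x‖
      · rw [indicator_of_mem (show x ∈ {x : E | (n : ℝ) + 1 ≤ ‖x‖} from hx), Real.norm_eq_abs,
          abs_mul, abs_of_nonneg (hG0 s hs x)]
        have h1 : |g s x - gR n s x| ≤ C := by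
          rw [hC]
          exact (abs_sub _ _).trans (add_le_add ((hgf s hs).1 x) ((hgRf n s hs).1 x))
        exact mul_le_mul h1 (hGM s hs x) (hG0 s hs x) ((abs_nonneg _).trans h1)
      · rw [indicator_of_notMem (show x ∉ {x : E | (n : ℝ) + 1 ≤ ‖x‖} from hx),
          hgRg n s x (not_le.mp hx), sub_self, zero_mul, norm_zero, mul_zero]
    rw [dist_eq_norm, ← integral_sub (hgf s hs).2 (hgRf n s hs).2]
    calc ‖∫ x, (g s x * G s x - gR n s x * G s x)‖
        = ‖∫ x, (g s x - gR n s x) * G s x‖ := by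
          congr 1; exact integral_congr_ae (Eventually.of_forall fun x => by ring)
      _ ≤ ∫ x, C * indicator {x : E | (n : ℝ) + 1 ≤ ‖x‖} M x :=
          norm_integral_le_of_norm_le ((hM.indicator hmeas).const_mul C)
            (Eventually.of_forall hbound)
      _ = C * ∫ x, indicator {x : E | (n : ℝ) + 1 ≤ ‖x‖} M x := integral_const_mul _ _
      _ < ε := hn
  -- conclusion
  have key := hasDerivAt_of_tendstoUniformlyOn hS₀ hf' hf hfg ht
  refine key.congr_deriv ?_
  rw [hg]
  exact integral_congr_ae (Eventually.of_forall fun x => by simp only [hder t ht])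


end General

end Summit.NavierStokesRegularity.NavierStokesRegularity.Theorems.AdaptedFrequencyConverges.TauberianOmegaLimit

end
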